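import Summits.BirchSwinnertonDyer.BirchSwinnertonDyer.Theses.ThetaPartnerAtTwo
import Summits.BirchSwinnertonDyer.BirchSwinnertonDyer.Theses.ResidualThetaTransportAtTwo
import Summits.BirchSwinnertonDyer.BirchSwinnertonDyer.Theorems.ThetaPartnerAtTwoSignedControlAtTwoCasselsOfPT
import Summits.BirchSwinnertonDyer.BirchSwinnertonDyer.Theorems.ThetaPartnerAtTwoSignedControlAtTwoCoinvOfResTwo
import Summits.BirchSwinnertonDyer.BirchSwinnertonDyer.Theorems.ThetaPartnerAtTwoSignedControlAtTwoResTwoOfShaTwo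
import Summits.BirchSwinnertonDyer.BirchSwinnertonDyer.Theorems.ThetaPartnerAtTwoSignedControlAtTwoShaTwoPrimaryVanishing
import Summits.BirchSwinnertonDyer.BirchSwinnertonDyer.Theorems.ThetaPartnerAtTwoSignedControlAtTwoShaThreeSylowField
import Literature.NumberTheory.GaloisCohomology.PoitouTateTwoRealPlacesSurjectiveHolds
import Summits.BirchSwinnertonDyer.BirchSwinnertonDyer.Theorems.ThetaPartnerAtTwoSignedControlAtTwoShaThreeBaseH3Units
import Summits.BirchSwinnertonDyer.BirchSwinnertonDyer.Theorems.ThetaPartnerAtTwoSignedControlAtTwoStubPoitouTateShaRat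
import Summits.BirchSwinnertonDyer.BirchSwinnertonDyer.Theorems.ThetaPartnerAtTwoSignedControlAtTwoStubPoitouTateSelmerRat
import Summits.BirchSwinnertonDyer.BirchSwinnertonDyer.Theorems.ThetaPartnerAtTwoSignedControlAtTwoStubPoitouTateTwoRealRat
import HarnessLib

/-!
# K4 `SignedControlAtTwo` (stmt-BirchSwinnertonDyer-20309) — PROVED: line `eulerchar`, final assembly (lead bsd-wall-tp2-p3 g6,
# 2026-08-28T12:0xZ; skeleton v17 = v16 with the last stub discharged)

Route `route-BirchSwinnertonDyer-ThetaPartnerAtTwo` (TP2; crux shared with `ResidualThetaTransportAtTwo`), crux K4, rank 5.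
**`SignedControlAtTwo_proof : Summit.BirchSwinnertonDyer.BirchSwinnertonDyer.Theses.ThetaPartnerAtTwo.SignedControlAtTwo`** and
**`SignedControlAtTwo_rtt_proof : ….Theses.ResidualThetaTransportAtTwo.SignedControlAtTwo`** — sorry-free, standard axioms.

WHAT THE CRUX SAYS (habitat: `E/ℚ` globally minimal, good supersingular at `2` with `a₂ = 0`; the binders `¬ CM`, `r_an = 0` are idle):
(i) every signed Selmer dual datum `X⁺(E/ℚ_∞)` over the cyclotomic `ℤ₂`-extension is finitely generated over `Λ = ℤ₂⟦T⟧` (Kobayashi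
Thm. 1.2 at `2`, tree `SignedSelmerDualData.moduleFinite`); (ii) CONTROL: when `X⁺` is `Λ`-torsion with `Char = (g)` and `Sel_{2^∞}(E/ℚ)` is
finite, `g(0) ∼ 2^{v₂(∏ c_ℓ)} · #Sel_{2^∞}(E/ℚ)` up to a `2`-adic unit (B. D. Kim 2013 Cor. 3.15 at `p = 2`).

HOW IT IS PROVED (history v1 → v17 in the crux directory `Cruxes/SignedControlAtTwo/Lines/eulerchar.{lean,md}`; ~60 helper files
`Theorems/ThetaPartnerAtTwoSignedControlAtTwo*.lean` by leads g0–g6 and width seats w2–w5, k4-p1):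
* (ii) = `kimControl_at_of_signedEulerCharTwo` ∘ `SignedEC.ResTwo.signedEulerChar_two_of_cassels_of_resTwo` (Euler-characteristic form of
  Kim's control at `2`), whose two inputs are CASSELS surjectivity `Greenberg1999.casselsSurjectivity_H1Sigma ℚ` ⟸ Poitou–Tate for Selmer
  structures (`SignedEC.CasselsPT.casselsSurjectivity_H1Sigma_of_poitouTate`, w3 g5) and the injectivity of
  `res : H²(Γ_ℚ, E[2^∞]) → H²(Gal(ℚ̄/ℚ_∞), E[2^∞])` ⟸ `Ш²(ℚ, E[2^∞]) = 0` (`SignedEC.ResTwo.resTwo_injective_of_shaTwo`, w2 g5) ⟸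
  Poitou–Tate (a) + Milne I 4.10(c)₃ + Cor. 4.16 (`SignedEC.ShaTwo.stub_shaTwoPrimaryVanishing_of_poitouTate`, w2 g5).
* The four GENERIC class-field-theoretic inputs over `ℚ` are now TREE THEOREMS:
  `poitouTate_selmerStructure_duality ℚ` (Milne I 4.10(b) for Selmer structures: cell bsd-schneider door-c4 g18,
  `PoitouTateReduction.poitouTate_selmerStructure_duality_holds`, the idèle class formation road) ·
  `poitouTate_sha_tateDual ℚ` (Milne I 4.10(a): the `Ш²`-readout road — bsd-schneider doors c4/c5/c6 g17–g19, bsd-wall chl-p2 g6–g7,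
  k4-p1; assembled here as `poitouTateShaRat`) · `poitouTate_three_realPlaces_injective ℚ` (Milne I 4.10(c)₃: the lead g5's
  dévissage to the μ₂ base case + w3 g9's Tate `H³(Γ_F, F̄ˣ) = 0`, `SignedEC.ShaThreeBrauer.stub_realThreeOrderTwoBase`) ·
  `poitouTate_two_realPlaces_surjective ℚ` (Milne I Cor. 4.16: w2 g6's `poitouTate_two_realPlaces_surjective_holds`).

HONEST FRAMING: this closes ONE crux (K4) of ONE route; it is Kobayashi/Kim-type signed Iwasawa-theoretic CONTROL at `p = 2` on the
`a₂ = 0` supersingular row, resting on classical global duality (Poitou–Tate) now kernel-checked in the tree.  **BSD is NOT proved by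
this**; the route's other cruxes (signed main conjecture at `2`, Kato divisibility at `2`, …) remain open.

References: [Kobayashi2003] Thm. 1.2; [BDKim2013] Cor. 3.15; [MilneADT2006] I Thm. 4.10, Cor. 4.16, Lemma 4.13; [GreenbergLNM1716] §4;
[CasselsFrohlichANT1967] Ch. VII; [Howard2004HeegnerKolyvagin] Thm. 2.1.11; [Harari2020] Thm. 17.13.
-/

set_option autoImplicit false
set_option linter.dupNamespace false

noncomputable section

open Literature.NumberTheory.EllipticCurves Literature.NumberTheory.GaloisRepresentations
open Literature.NumberTheory.GaloisRepresentations.DiscreteGaloisModule (shaTwo)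

namespace Summit.BirchSwinnertonDyer.BirchSwinnertonDyer.Theorems.SignedControlAtTwoEulerChar

/-- DERIVED (was the v13 stub; PUB, GENERIC): **`H²(F, M) → ⊕_{v real} H²(F_v, M)` is surjective** for every number field `F` and
finite `M` (Milne ADT I Cor. 4.16) — width seat w2 g6's THEOREM `poitouTate_two_realPlaces_surjective_holds` (p618871, explicit carry cocycle
of a Kummer sign character; no class field theory). [cite: MilneADT2006, Ch. I, Cor. 4.16] -/
theorem poitouTateTwoRealAll :
    ∀ (F : Type) [Field F] [NumberField F],
      Literature.NumberTheory.GaloisCohomology.poitouTate_two_realPlaces_surjective F :=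
  Literature.NumberTheory.GaloisCohomology.poitouTate_two_realPlaces_surjective_holds

/-- DERIVED (was the v12 stub 3): **Milne I Thm. 4.10(c)₃ over `ℚ` for ALL finite `M`**, from the base case and Cor. 4.16 by the lead's
dévissage `ShaThree.poitouTate_three_realPlaces_injective_of_base` (p622411). [cite: MilneADT2006, Ch. I, Thm. 4.10(c)] -/
theorem poitouTateThreeRealRat :
    Literature.NumberTheory.GaloisCohomology.poitouTate_three_realPlaces_injective ℚ :=
  Summit.BirchSwinnertonDyer.BirchSwinnertonDyer.Theorems.SignedEC.ShaThree.poitouTate_three_realPlaces_injective_of_base ℚ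
    Summit.BirchSwinnertonDyer.BirchSwinnertonDyer.Theorems.SignedEC.ShaThreeBrauer.stub_realThreeOrderTwoBase poitouTateTwoRealAll

/-- DERIVED: **`Ш²(ℚ, E[2^∞]) = 0` on the row given `Sel_{2^∞}(E/ℚ)` finite**, from `poitouTateShaRat` and
the two derived real-place facts by w2 g5's `SignedEC.ShaTwo.stub_shaTwoPrimaryVanishing_of_poitouTate` (p613197).
[cite: MilneADT2006, Ch. I, Thm. 4.10(a),(c), Lemma 4.8, Cor. 4.16] [cite: GreenbergLNM1716, §4 p. 119] -/
theorem shaTwoPrimaryVanishing :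
    ∀ (W : WeierstrassCurve ℚ) [W.IsElliptic] [W.IsGloballyMinimal],
      Rank1Residual.GoodSS W 2 → W.frobeniusTrace 2 = 0 → Finite (W.selmerGroupPInfty 2) →
      ∀ c ∈ shaTwo (Summit.BirchSwinnertonDyer.Rank1Residual.X11b.LocBridge.primaryGaloisModule W 2), c = 0 :=
  Summit.BirchSwinnertonDyer.BirchSwinnertonDyer.Theorems.SignedEC.ShaTwo.stub_shaTwoPrimaryVanishing_of_poitouTate
    Summit.BirchSwinnertonDyer.BirchSwinnertonDyer.Theorems.SignedEC.PoitouTateShaRat.stub_poitouTateShaRat poitouTateThreeRealRat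
    Summit.BirchSwinnertonDyer.BirchSwinnertonDyer.Theorems.SignedEC.PoitouTateReal.stub_poitouTateTwoRealRat

/-- COMPOSITION (kernel-checked): both conjuncts of the crux body for EVERY curve of the row from the derived inputs —
(i) `SignedSelmerDualData.moduleFinite`; (ii) `kimControl_at_of_signedEulerCharTwo` ∘ `SignedEC.ResTwo.signedEulerChar_two_of_cassels_of_resTwo`
with Cassels from `SignedEC.CasselsPT.casselsSurjectivity_H1Sigma_of_poitouTate poitouTateSelmerRat` (unconditional since v15) and `hres` from
`SignedEC.ResTwo.resTwo_injective_of_shaTwo` ∘ `shaTwoPrimaryVanishing` (inside the `Finite Sel` binder).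
[cite: BDKim2013, Cor. 3.15] [cite: Kobayashi2003, Thm. 1.2] -/
theorem signedControl_body (W : WeierstrassCurve ℚ) [W.IsElliptic] [W.IsGloballyMinimal]
    (hss : Rank1Residual.GoodSS W 2) (ha : W.frobeniusTrace 2 = 0) :
    (∀ (κ : ZpExtension ℚ 2) (γ : Field.absoluteGaloisGroup ℚ), κ.IsCyclotomic → κ.IsTopGenerator γ →
        ∀ D : Kobayashi2003.SignedSelmerDualData W κ γ 1, Module.Finite (IwasawaAlgebra 2) D.X) ∧
      (∀ (κ : ZpExtension ℚ 2) (γ : Field.absoluteGaloisGroup ℚ), κ.IsCyclotomic → κ.IsTopGenerator γ →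
        ∀ (D : Kobayashi2003.SignedSelmerDualData W κ γ 1) [Module.Finite (IwasawaAlgebra 2) D.X],
          Module.IsTorsion (IwasawaAlgebra 2) D.X → ∀ g : IwasawaAlgebra 2, D.charIdeal = Ideal.span {g} →
          Finite (W.selmerGroupPInfty 2) →
          ∃ u : ℤ_[2]ˣ, ((PowerSeries.constantCoeff g : ℤ_[2]) : ℚ_[2]) =
            ((u : ℤ_[2]) : ℚ_[2]) * ((2 : ℕ) : ℚ_[2]) ^ (padicValNat 2 W.tamagawaProduct) *
              (Nat.card (W.selmerGroupPInfty 2) : ℚ_[2])) := by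
  have hC : Greenberg1999.casselsSurjectivity_H1Sigma ℚ :=
    Summit.BirchSwinnertonDyer.BirchSwinnertonDyer.Theorems.SignedEC.CasselsPT.casselsSurjectivity_H1Sigma_of_poitouTate
      Summit.BirchSwinnertonDyer.BirchSwinnertonDyer.Theorems.SignedEC.PoitouTateSelmerRat.stub_poitouTateSelmerRat
  refine ⟨fun _ _ _ hγ D ↦ Kobayashi2003.SignedSelmerDualData.moduleFinite hγ D, ?_⟩
  exact Summit.BirchSwinnertonDyer.BirchSwinnertonDyer.Theorems.kimControl_at_of_signedEulerCharTwo
    fun κ _ hκ hγ hSel ↦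
      Summit.BirchSwinnertonDyer.BirchSwinnertonDyer.Theorems.SignedEC.ResTwo.signedEulerChar_two_of_cassels_of_resTwo
        W κ hss ha hκ hγ hC
        (fun c hc ↦
          Summit.BirchSwinnertonDyer.BirchSwinnertonDyer.Theorems.SignedEC.ResTwo.resTwo_injective_of_shaTwo W κ hss
            (shaTwoPrimaryVanishing W hss ha hSel) c hc)
        hSel

/-- COMPOSITION: K4 BY NAME (route `ThetaPartnerAtTwo` copy) from `signedControl_body` — the binders `¬ W.HasCM`,
`W.analyticRank = 0` are idle. -/
theorem SignedControlAtTwo_proof :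
    Summit.BirchSwinnertonDyer.BirchSwinnertonDyer.Theses.ThetaPartnerAtTwo.SignedControlAtTwo := by
  intro W _ _ _ _ hss ha
  exact signedControl_body W hss ha

/-- COMPOSITION for the route `ResidualThetaTransportAtTwo` copy of the crux decl (identical body; the crux item is shared by both
routes). -/
theorem SignedControlAtTwo_rtt_proof :
    Summit.BirchSwinnertonDyer.BirchSwinnertonDyer.Theses.ResidualThetaTransportAtTwo.SignedControlAtTwo := by
  intro W _ _ _ _ hss ha
  exact signedControl_body W hss ha

end Summit.BirchSwinnertonDyer.BirchSwinnertonDyer.Theorems.SignedControlAtTwoEulerChar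

end
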